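import Summits.QuantumFields.YangMills.Theorems.BalabanUVNodesN19LawPriceAtScheme
import Summits.QuantumFields.YangMills.Theorems.BalabanUVNodesN19LawPriceTwoSided

/-!
# YM-DAG node N19 (= NE7 proper) — THE LAW-LEVEL PRICE AT THE SCHEME, III: geometric remainders give `dist_BL ≲ log K∕K`; the Kolmogorov price is infinite

Cell `pub-ymgap`, HUMAN RULING D-0062 (Track A), R141 (C) wider-strategy seat `pub-ymgap-dag-n19-e` (strategy s3 = ALTERNATIVE CURRENCY), generation
g18, module 5.  Route `Summits/QuantumFields/YangMills/Theses/BalabanUVNodes.lean` rev 25, cluster item K3⁷ «SpineGivenEndpointR13SepCoPH»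
(stmt-QuantumFields-20544, dag-lead WORDS-143); filed `--supports` that item `--as helper` (it proves no registered stub).  COUNT-NEUTRAL: bookkeeping ∕
elementary real analysis over Mathlib (`tsum_geometric_of_lt_one`, `Measure.dirac`) + the seat's p555512 `…N19LawPriceTwoSided` (`law_price_le_logRate`)
and p551618 `…N19LawPriceAtScheme` (`map_prodObs_Icc_compl`, `cgf_map_prodObs`) BY NAME; `Spine.NE7.Target` and `T4CauchySum.GeomRate` enter as
HYPOTHESES; no Theses import; NOT a discharge claim.

THE RESULTS.
* §1–§3 GEOMETRIC REMAINDERS.  If N19's remainders are geometric, `|δ_j| ≤ C·θ^j` (`T4CauchySum.GeomRate C θ δ`, `0 < θ < 1` — the shape Bałaban-type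
  schemes produce, King's (3.9) template), then the Cauchy tail is `τ_K ≤ B·θ^K`, `B = 2|vol|C∕(1−θ)` (§2), the window-closeness may be READ at
  `ε_K = max(B,1)·θ^K` with `L_K = K·log θ⁻¹ − log max(B,1) ∈ [aK∕2, 3aK∕2]` eventually (`a = log θ⁻¹`), and the rate function there is
  `≤ (1 + log max(1,3a∕2))·max(1,2∕a)·log(e+K)∕(1+K)` (§1).  ★★ `abs_integral_prodObs_sub_continuumLaw_le_geom`: under `Spine.NE7.Target vol l₀ δ
  (schemeZ S os)` + `GeomRate C θ δ`, with `ν` the continuum law of `∏os`: beyond an explicit step, for EVERY `Kg`-Lipschitz `g` with `|g| ≤ Gb` on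
  `[−1,1]`, `|∫ g(∏os) dgibbs_K − ∫ g dν| ≤ 384·c(l₀)·(1 + log max(1,3a∕2))·max(1,2∕a)·(Kg+Gb)·log(e+K)∕(1+K)` — `dist_BL(law_K, ν) ≲ log K ∕ K`;
  ★ `exists_continuumLaw_geomRate_of_target` (assembled under `Target` alone).  By p543481 ∕ p553677 no better order follows from window matching.
* §4 THE KOLMOGOROV (a fortiori total-variation) PRICE IS INFINITE (★ `kolmogorov_not_controlled`): for every window and every `ε > 0` two probability
  laws on `[0,1]` (`δ₀` and `δ_η`, `η = min(1, ε∕l₀)`: cgf's `t ↦ 0` and `t ↦ ηt`) with cgf's `ε`-close on `|t| ≤ l₀` whose distribution functions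
  differ by `1` at `0` — the law currency is paid in the weak (bounded-Lipschitz ∕ W₁) topology ONLY.

HONEST FRAMING (binding).  Bookkeeping ∕ elementary ∕ [folklore]; NO consumer in the DAG today.  Nothing of Bałaban's is instantiated; NE7 ∕ NE7b ∕ NE7c
NOT PRINTED, NOT proved; `Target` ∕ `GeomRate` are HYPOTHESES; N19 NOT discharged; count-neutral.  One finite `T⁴` programme at fixed `ε`; nothing
continuum ∕ `ℝ⁴` ∕ OS ∕ mass-gap ∕ Clay.  0 `def` ∕ 0 `sorry`.
-/

noncomputable section

open Set Filter Topology Real MeasureTheory ProbabilityTheory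

namespace Summit.QuantumFields.YangMills.Theorems.BalabanUVNodesN19LawPriceGeometric

open Literature.MathematicalPhysics.QuantumFieldTheory.Balaban1983to89
open T4CauchySum (MatchingModConstants genFun genFunLim GeomRate abs_genFun_sub_lim_le)
open T4GenFunBounds (schemeZ prodObs gibbsMeasure)
open Missing (TorusScheme)
open Summit.QuantumFields.BalabanUV.T4Continuum.Spine
open Summit.QuantumFields.YangMills.BalabanUVNodes.N19ExpectationCurrencyAtScheme (mul_nonneg_of_matchingModConstants)
open Summit.QuantumFields.YangMills.BalabanUVNodes.N19ContinuumLawAtScheme (genFunLim_eq_cgf_of_continuumLaw continuumLaw_of_target)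
open Summit.QuantumFields.YangMills.Theorems.BalabanUVNodesN19LawPriceAtScheme (map_prodObs_Icc_compl cgf_map_prodObs)
open Summit.QuantumFields.YangMills.Theorems.BalabanUVNodesN19LawPriceTwoSided (law_price_le_logRate)

/-! ## §1 The rate function along a geometric tail -/

/-- **THE RATE ALONG A GEOMETRIC TAIL.**  For `0 < a`, `0 ≤ K` and `x ∈ [aK∕2, 3aK∕2]`:
`log(e+x)∕(1+x) ≤ (1 + log max(1, 3a∕2))·max(1, 2∕a)·log(e+K)∕(1+K)`. [folklore] -/
theorem logRate_le_of_mem_Icc {a K x : ℝ} (ha : 0 < a) (hK : 0 ≤ K) (hx1 : a * K / 2 ≤ x) (hx2 : x ≤ 3 * a * K / 2) :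
    Real.log (Real.exp 1 + x) / (1 + x) ≤
      (1 + Real.log (max 1 (3 * a / 2))) * max 1 (2 / a) * (Real.log (Real.exp 1 + K) / (1 + K)) := by
  have he0 : 0 < Real.exp 1 := Real.exp_pos 1
  have hx0 : 0 ≤ x := le_trans (by positivity) hx1
  set M₁ : ℝ := max 1 (3 * a / 2) with hM₁
  set m : ℝ := max 1 (2 / a) with hm
  have hM₁1 : 1 ≤ M₁ := le_max_left _ _
  have hm1 : 1 ≤ m := le_max_left _ _
  have hma : 2 ≤ m * a := by
    calc (2 : ℝ) = 2 / a * a := by field_simp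
      _ ≤ m * a := mul_le_mul_of_nonneg_right (le_max_right _ _) ha.le
  have hlogM : 0 ≤ Real.log M₁ := Real.log_nonneg hM₁1
  have hlogK : 1 ≤ Real.log (Real.exp 1 + K) := by
    calc (1 : ℝ) = Real.log (Real.exp 1) := (Real.log_exp 1).symm
      _ ≤ Real.log (Real.exp 1 + K) := Real.log_le_log he0 (by linarith)
  -- numerator
  have hnum : Real.log (Real.exp 1 + x) ≤ (1 + Real.log M₁) * Real.log (Real.exp 1 + K) := by
    have h1 : Real.exp 1 + x ≤ M₁ * (Real.exp 1 + K) := by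
      have h2 : 3 * a / 2 ≤ M₁ := le_max_right _ _
      nlinarith
    calc Real.log (Real.exp 1 + x) ≤ Real.log (M₁ * (Real.exp 1 + K)) := Real.log_le_log (by positivity) h1
      _ = Real.log M₁ + Real.log (Real.exp 1 + K) := Real.log_mul (by positivity) (by positivity)
      _ ≤ Real.log M₁ * Real.log (Real.exp 1 + K) + Real.log (Real.exp 1 + K) := by nlinarith
      _ = (1 + Real.log M₁) * Real.log (Real.exp 1 + K) := by ring
  -- denominator
  have hden : (1 + K) / m ≤ 1 + x := by
    rw [div_le_iff₀ (by positivity)]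
    nlinarith
  calc Real.log (Real.exp 1 + x) / (1 + x) ≤ ((1 + Real.log M₁) * Real.log (Real.exp 1 + K)) / ((1 + K) / m) :=
        div_le_div₀ (by positivity) hnum (by positivity) hden
    _ = (1 + Real.log M₁) * m * (Real.log (Real.exp 1 + K) / (1 + K)) := by
        field_simp

/-! ## §2 The Cauchy tail of a geometric remainder -/

/-- **THE CAUCHY TAIL OF A GEOMETRIC REMAINDER.**  `|δ_j| ≤ Cθ^j` (`T4CauchySum.GeomRate C θ δ`, `0 ≤ θ < 1`) ⇒ `∑_m 2vol·δ_{K+m} ≤ (2|vol|C∕(1−θ))·θ^K`.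
[bookkeeping] -/
theorem tsum_tail_le_of_geomRate {C θ vol : ℝ} {δ : ℕ → ℝ} (hθ0 : 0 ≤ θ) (hθ1 : θ < 1) (hG : GeomRate C θ δ) (K : ℕ) :
    ∑' m, 2 * (vol * δ (K + m)) ≤ (2 * |vol| * C / (1 - θ)) * θ ^ K := by
  have hC : 0 ≤ C := by have h := hG 0; rw [pow_zero, mul_one] at h; exact (abs_nonneg _).trans h
  have hgeom : Summable fun m : ℕ => (2 * |vol| * C * θ ^ K) * θ ^ m := (summable_geometric_of_lt_one hθ0 hθ1).mul_left _
  have hle : ∀ m, 2 * (vol * δ (K + m)) ≤ (2 * |vol| * C * θ ^ K) * θ ^ m := fun m => by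
    have h1 : |δ (K + m)| ≤ C * θ ^ (K + m) := hG (K + m)
    calc 2 * (vol * δ (K + m)) ≤ |2 * (vol * δ (K + m))| := le_abs_self _
      _ = 2 * (|vol| * |δ (K + m)|) := by rw [abs_mul, abs_mul, abs_two]
      _ ≤ 2 * (|vol| * (C * θ ^ (K + m))) := by gcongr
      _ = (2 * |vol| * C * θ ^ K) * θ ^ m := by rw [pow_add]; ring
  have hnorm : ∀ m, ‖2 * (vol * δ (K + m))‖ ≤ (2 * |vol| * C * θ ^ K) * θ ^ m := fun m => by
    rw [Real.norm_eq_abs, abs_mul, abs_mul, abs_two]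
    have h1 : |δ (K + m)| ≤ C * θ ^ (K + m) := hG (K + m)
    calc 2 * (|vol| * |δ (K + m)|) ≤ 2 * (|vol| * (C * θ ^ (K + m))) := by gcongr
      _ = (2 * |vol| * C * θ ^ K) * θ ^ m := by rw [pow_add]; ring
  have hsum : Summable fun m : ℕ => 2 * (vol * δ (K + m)) := Summable.of_norm_bounded hgeom hnorm
  calc ∑' m, 2 * (vol * δ (K + m)) ≤ ∑' m : ℕ, (2 * |vol| * C * θ ^ K) * θ ^ m := Summable.tsum_le_tsum hle hsum hgeom
    _ = (2 * |vol| * C * θ ^ K) * (1 - θ)⁻¹ := by rw [tsum_mul_left, tsum_geometric_of_lt_one hθ0 hθ1]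
    _ = (2 * |vol| * C / (1 - θ)) * θ ^ K := by ring

/-! ## §3 At the scheme: geometric remainders give `dist_BL ≲ log K∕K` -/

section Scheme

variable {G : Type*} [GaugeGroup G] [MeasurableSpace G] [RegularGaugeGroup G] [HaarData G] {O : Type*}
  (S : TorusScheme G O) (hβ : ∀ K, 0 ≤ S.β K) (hm : ∀ K o, Measurable (S.obs K o))
  (h1 : ∀ K o U, |S.obs K o U| ≤ 1)
include hβ hm h1

/-- **★★ GEOMETRIC REMAINDERS GIVE `dist_BL(law_K, ν) ≲ log K∕K`.**  Under N19's DECL target `Spine.NE7.Target vol l₀ δ (schemeZ S os)` on `0 < l₀` with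
GEOMETRIC remainders `|δ_j| ≤ Cθ^j` (`T4CauchySum.GeomRate C θ δ`, `0 < θ < 1`; both HYPOTHESES), let `ν` be the continuum law of `∏os` (p505344).  Then
for every step `K ≥ 2·log max(B,1)∕log θ⁻¹` (`B = 2|vol|C∕(1−θ)`) and EVERY `Kg`-Lipschitz `g` with `|g| ≤ Gb` on `[−1,1]`:
`|∫ g(∏os) dgibbs_K − ∫ g dν| ≤ 384·c(l₀)·(1 + log max(1,3a∕2))·max(1,2∕a)·(Kg+Gb)·log(e+K)∕(1+K)`, `a = log θ⁻¹`, `c(l₀) = 6 + l₀ + log max(1,4e∕l₀)`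
— p555512 `law_price_le_logRate` read at `ε_K = max(B,1)θ^K ≥ τ_K` (§2), whose `L_K = aK − log max(B,1) ∈ [aK∕2, 3aK∕2]`, and §1. [bookkeeping] -/
theorem abs_integral_prodObs_sub_continuumLaw_le_geom {vol l₀ C θ : ℝ} {δ : ℕ → ℝ} (hl₀ : 0 < l₀) (hθ0 : 0 < θ) (hθ1 : θ < 1)
    (hGR : GeomRate C θ δ) (os : List O)
    (hT : NE7.Target vol l₀ δ (schemeZ S os)) (ν : Measure ℝ) [IsProbabilityMeasure ν] (hν1 : ν (Icc (-1) 1)ᶜ = 0)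
    (hν : ∀ f : ℝ → ℝ, Continuous f →
      Tendsto (fun K => ∫ U, f (prodObs S K os U) ∂gibbsMeasure (S.P K) (S.β K)) atTop (𝓝 (∫ x, f x ∂ν)))
    {g : ℝ → ℝ} {Kg : NNReal} (hg : LipschitzWith Kg g) {Gb : ℝ} (hG : ∀ x ∈ Icc (-1 : ℝ) 1, |g x| ≤ Gb) (K : ℕ)
    (hK : 2 * Real.log (max (2 * |vol| * C / (1 - θ)) 1) / Real.log θ⁻¹ ≤ K) :
    |∫ U, g (prodObs S K os U) ∂gibbsMeasure (S.P K) (S.β K) - ∫ x, g x ∂ν| ≤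
      384 * (6 + l₀ + Real.log (max 1 (4 * Real.exp 1 / l₀))) *
        ((1 + Real.log (max 1 (3 * Real.log θ⁻¹ / 2))) * max 1 (2 / Real.log θ⁻¹)) * (Kg + Gb) *
          (Real.log (Real.exp 1 + K) / (1 + K)) := by
  obtain ⟨hM, hδ⟩ := hT
  haveI hP : IsProbabilityMeasure (gibbsMeasure (G := G) (S.P K) (S.β K)) :=
    T4GenFunBounds.isProbabilityMeasure_gibbsMeasure (G := G) (S.P K) (hβ K)
  set μK : Measure ℝ := (gibbsMeasure (S.P K) (S.β K)).map (prodObs S K os) with hμK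
  haveI : IsProbabilityMeasure μK := Measure.isProbabilityMeasure_map (T4GenFunBounds.measurable_prodObs S hm K os).aemeasurable
  -- the reading parameter `ε_K = max(B,1)·θ^K`
  set B' : ℝ := max (2 * |vol| * C / (1 - θ)) 1 with hB'
  have hB'1 : 1 ≤ B' := le_max_right _ _
  have hB'0 : 0 < B' := by positivity
  set a : ℝ := Real.log θ⁻¹ with ha
  have ha0 : 0 < a := Real.log_pos ((one_lt_inv₀ hθ0).2 hθ1)
  set ε : ℝ := B' * θ ^ K with hε
  have hε0 : 0 < ε := by positivity
  have hKr : (0 : ℝ) ≤ K := Nat.cast_nonneg K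
  have hlogB : 0 ≤ Real.log B' := Real.log_nonneg hB'1
  have hKa : 2 * Real.log B' ≤ a * K := by
    have h := (div_le_iff₀ ha0).1 hK
    linarith
  -- `L = log ε⁻¹ = aK − log B'`
  have hLeq : Real.log ε⁻¹ = a * K - Real.log B' := by
    rw [hε, mul_inv, Real.log_mul (inv_ne_zero hB'0.ne') (by positivity), Real.log_inv, ← inv_pow, Real.log_pow, ha]
    ring
  have hε1 : ε ≤ 1 := by
    have h1 : 0 ≤ Real.log ε⁻¹ := by rw [hLeq]; linarith
    have h2 : 1 ≤ ε⁻¹ := by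
      by_contra h3
      push Not at h3
      have := Real.log_neg (inv_pos.2 hε0) h3
      linarith
    exact (one_le_inv_iff₀.1 h2).2
  have hLpos : Real.posLog ε⁻¹ = a * K - Real.log B' := by
    rw [Real.posLog_eq_log (by rw [abs_of_pos (inv_pos.2 hε0)]; exact one_le_inv_iff₀.2 ⟨hε0, hε1⟩), hLeq]
  -- cgf's of `μK` and `ν` are `ε`-close on the window (`τ_K ≤ B θ^K ≤ ε`)
  have hτ : ∑' m, 2 * (vol * δ (K + m)) ≤ ε := by
    refine (tsum_tail_le_of_geomRate hθ0.le hθ1 hGR K).trans ?_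
    exact mul_le_mul_of_nonneg_right (le_max_left _ _) (by positivity)
  have hclose : ∀ t : ℝ, |t| ≤ l₀ → |cgf id ν t - cgf id μK t| ≤ ε := fun t ht => by
    rw [hμK, cgf_map_prodObs S hβ hm h1 K os t, ← (genFunLim_eq_cgf_of_continuumLaw S hβ hm h1 os ν hν t).2, abs_sub_comm]
    exact (abs_genFun_sub_lim_le hM hl₀.le hδ ht K).trans hτ
  have h := law_price_le_logRate (μ := μK) (ν := ν) (map_prodObs_Icc_compl S hm h1 K os) hν1 hl₀ hε0 hε1 hclose hg hG
  rw [hμK, integral_map (T4GenFunBounds.measurable_prodObs S hm K os).aemeasurable hg.continuous.aestronglyMeasurable, abs_sub_comm, hLpos] at h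
  -- the rate at `L = aK − log B' ∈ [aK/2, 3aK/2]`
  have hrate := logRate_le_of_mem_Icc (x := a * K - Real.log B') ha0 hKr (by linarith) (by nlinarith)
  have hG0 : 0 ≤ Gb := (abs_nonneg _).trans (hG 0 (by norm_num))
  have hc0 : 0 ≤ 6 + l₀ + Real.log (max 1 (4 * Real.exp 1 / l₀)) := by
    have := Real.log_nonneg (le_max_left 1 (4 * Real.exp 1 / l₀)); linarith
  refine h.trans ?_
  have hcoef : 0 ≤ 384 * (6 + l₀ + Real.log (max 1 (4 * Real.exp 1 / l₀))) * (Kg + Gb) := by positivity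
  calc 384 * (6 + l₀ + Real.log (max 1 (4 * Real.exp 1 / l₀))) * (Kg + Gb) *
        (Real.log (Real.exp 1 + (a * K - Real.log B')) / (1 + (a * K - Real.log B')))
      ≤ 384 * (6 + l₀ + Real.log (max 1 (4 * Real.exp 1 / l₀))) * (Kg + Gb) *
        ((1 + Real.log (max 1 (3 * a / 2))) * max 1 (2 / a) * (Real.log (Real.exp 1 + K) / (1 + K))) :=
        mul_le_mul_of_nonneg_left hrate hcoef
    _ = _ := by ring

/-- **★ ASSEMBLED UNDER `Target` + `GeomRate` ALONE.**  Under `Spine.NE7.Target vol l₀ δ (schemeZ S os)` (`0 < l₀`) with `GeomRate C θ δ` (`0 < θ < 1`)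
there are a probability law `ν` on `[−1,1]` (the weak limit of the laws of `∏os`) and a step `K₁` beyond which every `Kg`-Lipschitz `g` with `|g| ≤ Gb`
on `[−1,1]` has `|∫ g(∏os) dgibbs_K − ∫ g dν| ≤ C(l₀,θ)·(Kg+Gb)·log(e+K)∕(1+K)` with the displayed constant. [bookkeeping] -/
theorem exists_continuumLaw_geomRate_of_target {vol l₀ C θ : ℝ} {δ : ℕ → ℝ} (hl₀ : 0 < l₀) (hθ0 : 0 < θ) (hθ1 : θ < 1)
    (hGR : GeomRate C θ δ) (os : List O) (hT : NE7.Target vol l₀ δ (schemeZ S os)) :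
    ∃ ν : Measure ℝ, IsProbabilityMeasure ν ∧ ν (Icc (-1) 1)ᶜ = 0 ∧
      (∀ f : ℝ → ℝ, Continuous f →
        Tendsto (fun K => ∫ U, f (prodObs S K os U) ∂gibbsMeasure (S.P K) (S.β K)) atTop (𝓝 (∫ x, f x ∂ν))) ∧
      ∃ K₁ : ℕ, ∀ K, K₁ ≤ K → ∀ (g : ℝ → ℝ) (Kg : NNReal) (Gb : ℝ), LipschitzWith Kg g → (∀ x ∈ Icc (-1 : ℝ) 1, |g x| ≤ Gb) →
        |∫ U, g (prodObs S K os U) ∂gibbsMeasure (S.P K) (S.β K) - ∫ x, g x ∂ν| ≤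
          384 * (6 + l₀ + Real.log (max 1 (4 * Real.exp 1 / l₀))) *
            ((1 + Real.log (max 1 (3 * Real.log θ⁻¹ / 2))) * max 1 (2 / Real.log θ⁻¹)) * (Kg + Gb) *
              (Real.log (Real.exp 1 + K) / (1 + K)) := by
  obtain ⟨ν, iν, hν1, hν, -⟩ := continuumLaw_of_target S hβ hm h1 hl₀ os hT
  obtain ⟨K₁, hK₁⟩ := exists_nat_ge (2 * Real.log (max (2 * |vol| * C / (1 - θ)) 1) / Real.log θ⁻¹)
  refine ⟨ν, iν, hν1, hν, K₁, fun K hK g Kg Gb hg hG => ?_⟩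
  exact abs_integral_prodObs_sub_continuumLaw_le_geom S hβ hm h1 hl₀ hθ0 hθ1 hGR os hT ν hν1 hν hg hG K
    (hK₁.trans (by exact_mod_cast hK))

end Scheme

/-! ## §4 The Kolmogorov price is infinite -/

/-- **★ THE KOLMOGOROV (a fortiori TOTAL-VARIATION) PRICE OF WINDOW MATCHING IS INFINITE.**  For every window `0 < l₀` and every `ε > 0` there are two
probability laws on `[0,1]` — `δ₀` and `δ_η`, `η = min(1, ε∕l₀)`, with cgf's `t ↦ 0` and `t ↦ ηt` — whose cgf's are `ε`-close on `|t| ≤ l₀` while their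
distribution functions differ by `1` at `0`: `μ(−∞,0] = 1`, `ν(−∞,0] = 0`.  So N19's currency controls the law in the weak (bounded-Lipschitz ∕ W₁)
topology ONLY (p555512: at the price `log(e+L)∕(1+L)`); no Kolmogorov ∕ total-variation estimate whatsoever follows from window matching. [folklore] -/
theorem kolmogorov_not_controlled {l₀ : ℝ} (hl₀ : 0 < l₀) {ε : ℝ} (hε : 0 < ε) :
    ∃ μ ν : Measure ℝ, IsProbabilityMeasure μ ∧ IsProbabilityMeasure ν ∧
      μ (Icc 0 1)ᶜ = 0 ∧ ν (Icc 0 1)ᶜ = 0 ∧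
      (∀ t : ℝ, |t| ≤ l₀ → |cgf id ν t - cgf id μ t| ≤ ε) ∧
      μ (Iic 0) = 1 ∧ ν (Iic 0) = 0 := by
  set η : ℝ := min 1 (ε / l₀) with hη
  have hη0 : 0 < η := lt_min one_pos (div_pos hε hl₀)
  have hη1 : η ≤ 1 := min_le_left _ _
  have hηε : l₀ * η ≤ ε := by
    calc l₀ * η ≤ l₀ * (ε / l₀) := mul_le_mul_of_nonneg_left (min_le_right _ _) hl₀.le
      _ = ε := mul_div_cancel₀ _ hl₀.ne'
  have hcgf : ∀ (a t : ℝ), cgf id (Measure.dirac a) t = t * a := fun a t => by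
    rw [cgf, mgf_dirac', id, Real.log_exp]
  refine ⟨Measure.dirac 0, Measure.dirac η, inferInstance, inferInstance, ?_, ?_, fun t ht => ?_, ?_, ?_⟩
  · rw [Measure.dirac_apply' _ measurableSet_Icc.compl, Set.indicator_of_notMem]
    exact fun h => h ⟨le_rfl, zero_le_one⟩
  · rw [Measure.dirac_apply' _ measurableSet_Icc.compl, Set.indicator_of_notMem]
    exact fun h => h ⟨hη0.le, hη1⟩
  · rw [hcgf, hcgf, mul_zero, sub_zero, abs_mul, abs_of_pos hη0]
    exact (mul_le_mul_of_nonneg_right ht hη0.le).trans hηε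
  · exact Measure.dirac_apply_of_mem (Set.mem_Iic.2 le_rfl)
  · rw [Measure.dirac_apply' _ measurableSet_Iic, Set.indicator_of_notMem]
    exact fun h => (not_le.2 hη0) (Set.mem_Iic.1 h)

end Summit.QuantumFields.YangMills.Theorems.BalabanUVNodesN19LawPriceGeometric

end
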